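import Summits.Ventures.HSemireg.WedgeHankelRecurrenceGaussChebyshevTUCoprimeIff

/-!
# Venture HSemireg — **THE MIXED RESULTANT IN CLOSED FORM: `Res_{(m,n)}(T_m, U_n) = 0` IF `(n+1) ∕ gcd(m, n+1)` IS EVEN, AND `= (−1)^{mn∕2} · 2^{mn + gcd(m,n+1) − n − 1}` OTHERWISE**
# (Mathlib's `T`, `U`; integer resultant with formal degrees `m`, `n`) — completing the trio with N460 (`U` against `U`) and N461 (`T` against `T`); the engine is FOUR EUCLIDEAN STEPS FOR
# RESULTANTS: the shift `U_{j+2M} = −U_j + T_M (2 U_{j+M})` and the reflection `U_{k+M} = U_{M−k−2} + T_M (2 U_k)` on the `U`-side (factor `(∓1)^M (2^{M−1})^{padding}`), the shift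
# `T_{i+2n} = T_i + U_{n−1} (2 (X²−1) U_{i+n−1})` and the reflection `T_{k+n} = T_{n−k} + U_{n−1} (2 (X²−1) U_{k−1})` on the `T`-side (factor `(2^{n−1})^{padding}`), the degenerate value
# `Res(T_M, U_{2M−1}) = 0` (`U_{2M−1} = 2 T_M U_{M−1}`) and the consecutive value `Res_{(n+1,n)}(T_{n+1}, U_n) = Res(U_{n+1}, U_n)`; then the alternating descent of N462

HONEST FRAMING. Part of the Lean index of the computation cell `pub-hsemireg` (seat p10 gen 48, Sunday typer «UNIFORM-IN-n»).  Polynomial ∕ resultant algebra over `ℤ` and `ℕ`-parity bookkeeping only;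
no variety, no cohomology theory, no sheaf, no Ext group and no semiregularity map is constructed here; nothing here says that HC / HC_CM / HC_AV holds; no Literature fact (unproved `Prop`) is
declared or used.  Custodian versions as in `WedgeHankelSiegelIdeal` (1/3).
SOURCES (cited).  K. Dilcher, K. B. Stolarsky, *Resultants and discriminants of Chebyshev and related polynomials*, Trans. Amer. Math. Soc. 357 (2005) 965–981, §3 (resultants of pairs from `{T_m, U_n}`);
D. P. Jacobs, M. O. Rayes, V. Trevisan, *The resultant of Chebyshev polynomials*, Canad. Math. Bull. 54 (2011) 288–296.  The closed form (vanishing locus, sign `(−1)^{mn∕2}` and exponent) was checked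
against exact Sylvester determinants for `1 ≤ m ≤ 7`, `0 ≤ n ≤ 7` (seat folder `work/py/mixed.py`); the printed normalisations differ between sources, the statement below is Mathlib's.
PROOF TYPED HERE.  N438 `chebyshevT_mul_U`; N462 `chebyshevT_add_sub_T_sub`; N406 `chebyshevT_natDegree_coeff`, `chebyshevU_natDegree_coeff`, `chebyshevU_resultant`; N458 bookkeeping lemmas; Mathlib
`resultant_add_mul_right ∕ _left`, `resultant_add_right_deg ∕ _left_deg`, `resultant_C_mul_right`, `resultant_zero_right`, `resultant_one_left`, `T_eq_U_sub_X_mul_U`, `U_neg`, `U_neg_one`, `T_neg`.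
DEDUP DISCLOSURE (`rg -n 'chebyshevTU_resultant_of_U_rel|chebyshevTU_resultant_of_T_rel|chebyshevTU_resultant_U_|chebyshevTU_resultant_T_|chebyshevTU_resultant_pred_succ|chebyshevTU_resultant_closed|
succ_le_mul_add_gcd|even_mul_of_not_even_div' Summits Literature HarnessLib`, 2026-09-04): N432 `chebyshevTU_resultant_succ ∕ _same`, N440 `chebyshevTU_resultant_gap_two` (special index pairs); 0 hits for
the 11 names below.

WHAT IS IN THE TREE.  N406, N432, N438, N440, N458, N460–N463.
THIS FILE (namespace `Summit.Ventures.HSemireg.Wedge.HankelOuter` continued; CHAINED on N463; 0 definitions):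
* §1229 `succ_le_mul_add_gcd` (bookkeeping), `chebyshevTU_resultant_of_U_rel`, `chebyshevTU_resultant_of_T_rel` (resultant bookkeeping), **`chebyshevTU_resultant_U_add_two_mul`**,
  **`chebyshevTU_resultant_U_reflect`**, `chebyshevTU_resultant_U_two_mul_pred` (`= 0`), **`chebyshevTU_resultant_T_add_two_mul`**, **`chebyshevTU_resultant_T_reflect`**,
  `chebyshevTU_resultant_pred_succ` (consecutive value), `even_mul_of_not_even_div` (bookkeeping), **`chebyshevTU_resultant_closed`**.
CAVEATS.  `mn ∕ 2` is `ℕ`-division (exact whenever the resultant is non-zero); `mn + gcd(m,n+1) − n − 1` is `ℕ`-subtraction without truncation (`succ_le_mul_add_gcd`).  Formal degrees explicit.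
Nothing Ext-side.  New names only.
-/

open Module Polynomial
open scoped Matrix Polynomial

namespace Summit.Ventures.HSemireg.Wedge.HankelOuter

/-! ## §1229. `Res(T_m, U_n)` in closed form -/

/-- Bookkeeping: `n + 1 ≤ mn + gcd(m, n+1)` (no truncated subtraction in the exponent). [this file, §1229] -/
theorem succ_le_mul_add_gcd (m n : ℕ) : n + 1 ≤ m * n + Nat.gcd m (n + 1) := by
  rcases Nat.eq_zero_or_pos m with rfl | hm
  · simp
  have hg : 1 ≤ Nat.gcd m (n + 1) := Nat.gcd_pos_of_pos_left _ hm
  nlinarith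

/-- `U`-side resultant bookkeeping: if `U_N = ε U_j + T_{m+1} (2 U_i)` with `i + (m+1) ≤ N = j + k`, then `Res_{(m+1,N)}(T_{m+1}, U_N) = ε^{m+1} (2^m)^k Res_{(m+1,j)}(T_{m+1}, U_j)`.
[this file, §1229] -/
theorem chebyshevTU_resultant_of_U_rel {m j i N k : ℕ} {ε : ℤ}
    (hrel : Polynomial.Chebyshev.U ℤ (N : ℤ) = C ε * Polynomial.Chebyshev.U ℤ (j : ℤ) + Polynomial.Chebyshev.T ℤ ((m + 1 : ℕ) : ℤ) * (2 * Polynomial.Chebyshev.U ℤ (i : ℤ)))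
    (hdeg : i + (m + 1) ≤ N) (hk : N = j + k) :
    (Polynomial.Chebyshev.T ℤ ((m + 1 : ℕ) : ℤ)).resultant (Polynomial.Chebyshev.U ℤ (N : ℤ)) (m + 1) N =
      ε ^ (m + 1) * (2 ^ m) ^ k * (Polynomial.Chebyshev.T ℤ ((m + 1 : ℕ) : ℤ)).resultant (Polynomial.Chebyshev.U ℤ (j : ℤ)) (m + 1) j := by
  obtain ⟨hdegT, hcoeff⟩ := chebyshevT_natDegree_coeff m
  rw [show (m : ℤ) + 1 = ((m + 1 : ℕ) : ℤ) by push_cast; ring] at hdegT hcoeff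
  have hf : (Polynomial.Chebyshev.T ℤ ((m + 1 : ℕ) : ℤ)).natDegree ≤ m + 1 := hdegT.le
  have hp : (2 * Polynomial.Chebyshev.U ℤ (i : ℤ)).natDegree + (m + 1) ≤ N := by
    refine le_trans (Nat.add_le_add_right (Polynomial.natDegree_mul_le.trans ?_) _) hdeg
    rw [show (2 : ℤ[X]) = C 2 from (Polynomial.C_ofNat 2).symm, natDegree_C, zero_add, Polynomial.Chebyshev.natDegree_U_natCast]
  have hg : (C ε * Polynomial.Chebyshev.U ℤ (j : ℤ)).natDegree ≤ j :=
    (Polynomial.natDegree_C_mul_le _ _).trans (Polynomial.Chebyshev.natDegree_U_natCast ℤ j).le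
  rw [hrel, Polynomial.resultant_add_mul_right _ _ _ _ _ hp hf, hk, Polynomial.resultant_add_right_deg _ _ _ _ k hg, hcoeff, Polynomial.resultant_C_mul_right]
  ring

/-- `T`-side resultant bookkeeping: if `T_M = T_i + U_u · p` with `deg p + u ≤ M = i + k`, then `Res_{(M,u)}(T_M, U_u) = (−1)^{uk} (2^u)^k Res_{(i,u)}(T_i, U_u)`. [this file, §1229] -/
theorem chebyshevTU_resultant_of_T_rel {M i u k : ℕ} {p : ℤ[X]}
    (hrel : Polynomial.Chebyshev.T ℤ (M : ℤ) = Polynomial.Chebyshev.T ℤ (i : ℤ) + Polynomial.Chebyshev.U ℤ (u : ℤ) * p) (hdeg : p.natDegree + u ≤ M) (hk : M = i + k) :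
    (Polynomial.Chebyshev.T ℤ (M : ℤ)).resultant (Polynomial.Chebyshev.U ℤ (u : ℤ)) M u =
      (-1) ^ (u * k) * (2 ^ u) ^ k * (Polynomial.Chebyshev.T ℤ (i : ℤ)).resultant (Polynomial.Chebyshev.U ℤ (u : ℤ)) i u := by
  obtain ⟨hdegU, hcoeff⟩ := chebyshevU_natDegree_coeff u
  have hg : (Polynomial.Chebyshev.U ℤ (u : ℤ)).natDegree ≤ u := hdegU.le
  have hf : (Polynomial.Chebyshev.T ℤ (i : ℤ)).natDegree ≤ i := by rw [Polynomial.Chebyshev.natDegree_T, Int.natAbs_natCast]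
  rw [hrel, Polynomial.resultant_add_mul_left _ _ _ _ _ hdeg hg, hk, Polynomial.resultant_add_left_deg _ _ _ _ _ hf, hcoeff]

/-- **`U`-SHIFT: `Res_{(m+1, j+2(m+1))}(T_{m+1}, U_{j+2(m+1)}) = (−1)^{m+1} (2^m)^{2(m+1)} Res_{(m+1,j)}(T_{m+1}, U_j)`** (from `2 T_M U_{j+M} = U_{j+2M} + U_j`). [this file, §1229] -/
theorem chebyshevTU_resultant_U_add_two_mul (m j : ℕ) :
    (Polynomial.Chebyshev.T ℤ ((m + 1 : ℕ) : ℤ)).resultant (Polynomial.Chebyshev.U ℤ ((j + 2 * (m + 1) : ℕ) : ℤ)) (m + 1) (j + 2 * (m + 1)) =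
      (-1) ^ (m + 1) * (2 ^ m) ^ (2 * (m + 1)) * (Polynomial.Chebyshev.T ℤ ((m + 1 : ℕ) : ℤ)).resultant (Polynomial.Chebyshev.U ℤ (j : ℤ)) (m + 1) j := by
  refine chebyshevTU_resultant_of_U_rel (i := j + (m + 1)) (ε := -1) ?_ (by omega) rfl
  have h := chebyshevT_mul_U (R := ℤ) ((m + 1 : ℕ) : ℤ) ((j + (m + 1) : ℕ) : ℤ)
  rw [show ((j + (m + 1) : ℕ) : ℤ) + ((m + 1 : ℕ) : ℤ) = ((j + 2 * (m + 1) : ℕ) : ℤ) by push_cast; ring,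
    show ((j + (m + 1) : ℕ) : ℤ) - ((m + 1 : ℕ) : ℤ) = (j : ℤ) by push_cast; ring] at h
  rw [C_neg, C_1]
  linear_combination (-1 : ℤ[X]) * h

/-- **`U`-REFLECTION: for `j + k + 1 = m`, `Res_{(m+1, k+(m+1))}(T_{m+1}, U_{k+(m+1)}) = (2^m)^{2(k+1)} Res_{(m+1,j)}(T_{m+1}, U_j)`** (from `2 T_M U_k = U_{k+M} − U_{M−k−2}`). [this file, §1229] -/
theorem chebyshevTU_resultant_U_reflect {m j k : ℕ} (hjk : j + k + 1 = m) :
    (Polynomial.Chebyshev.T ℤ ((m + 1 : ℕ) : ℤ)).resultant (Polynomial.Chebyshev.U ℤ ((k + (m + 1) : ℕ) : ℤ)) (m + 1) (k + (m + 1)) =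
      (2 ^ m) ^ (2 * (k + 1)) * (Polynomial.Chebyshev.T ℤ ((m + 1 : ℕ) : ℤ)).resultant (Polynomial.Chebyshev.U ℤ (j : ℤ)) (m + 1) j := by
  have h1 := chebyshevTU_resultant_of_U_rel (m := m) (j := j) (i := k) (N := k + (m + 1)) (k := 2 * (k + 1)) (ε := 1) ?_ (by omega) (by omega)
  · rw [h1, one_pow, one_mul]
  have h := chebyshevT_mul_U (R := ℤ) ((m + 1 : ℕ) : ℤ) (k : ℤ)
  rw [show (k : ℤ) + ((m + 1 : ℕ) : ℤ) = ((k + (m + 1) : ℕ) : ℤ) by push_cast; ring,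
    show (k : ℤ) - ((m + 1 : ℕ) : ℤ) = -((j : ℤ) + 2) by push_cast; omega, Polynomial.Chebyshev.U_neg, add_sub_cancel_right] at h
  rw [C_1]
  linear_combination (-1 : ℤ[X]) * h

/-- `Res_{(m+1, 2m+1)}(T_{m+1}, U_{2m+1}) = 0` (`U_{2M−1} = 2 T_M U_{M−1}`). [this file, §1229] -/
theorem chebyshevTU_resultant_U_two_mul_pred (m : ℕ) :
    (Polynomial.Chebyshev.T ℤ ((m + 1 : ℕ) : ℤ)).resultant (Polynomial.Chebyshev.U ℤ ((2 * m + 1 : ℕ) : ℤ)) (m + 1) (2 * m + 1) = 0 := by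
  obtain ⟨hdegT, -⟩ := chebyshevT_natDegree_coeff m
  rw [show (m : ℤ) + 1 = ((m + 1 : ℕ) : ℤ) by push_cast; ring] at hdegT
  have h := chebyshevT_mul_U (R := ℤ) ((m + 1 : ℕ) : ℤ) (m : ℤ)
  rw [show (m : ℤ) + ((m + 1 : ℕ) : ℤ) = ((2 * m + 1 : ℕ) : ℤ) by push_cast; ring,
    show (m : ℤ) - ((m + 1 : ℕ) : ℤ) = -1 by push_cast; ring, Polynomial.Chebyshev.U_neg_one, add_zero] at h
  have hrel : Polynomial.Chebyshev.U ℤ ((2 * m + 1 : ℕ) : ℤ) = 0 + Polynomial.Chebyshev.T ℤ ((m + 1 : ℕ) : ℤ) * (2 * Polynomial.Chebyshev.U ℤ (m : ℤ)) := by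
    linear_combination (-1 : ℤ[X]) * h
  have hp : (2 * Polynomial.Chebyshev.U ℤ (m : ℤ)).natDegree + (m + 1) ≤ 2 * m + 1 := by
    refine le_trans (Nat.add_le_add_right (Polynomial.natDegree_mul_le.trans ?_) _) (by omega : m + (m + 1) ≤ 2 * m + 1)
    rw [show (2 : ℤ[X]) = C 2 from (Polynomial.C_ofNat 2).symm, natDegree_C, zero_add, Polynomial.Chebyshev.natDegree_U_natCast]
  rw [hrel, Polynomial.resultant_add_mul_right _ _ _ _ _ hp hdegT.le, Polynomial.resultant_zero_right, zero_pow (Nat.succ_ne_zero m), zero_mul]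

/-- **`T`-SHIFT: `Res_{(i+2(u+1), u)}(T_{i+2(u+1)}, U_u) = (2^u)^{2(u+1)} Res_{(i,u)}(T_i, U_u)`** (from `T_{i+2n} − T_i = 2(X²−1) U_{n−1} U_{i+n−1}`). [this file, §1229] -/
theorem chebyshevTU_resultant_T_add_two_mul (i u : ℕ) :
    (Polynomial.Chebyshev.T ℤ ((i + 2 * (u + 1) : ℕ) : ℤ)).resultant (Polynomial.Chebyshev.U ℤ (u : ℤ)) (i + 2 * (u + 1)) u =
      (2 ^ u) ^ (2 * (u + 1)) * (Polynomial.Chebyshev.T ℤ (i : ℤ)).resultant (Polynomial.Chebyshev.U ℤ (u : ℤ)) i u := by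
  have h := chebyshevT_add_sub_T_sub (R := ℤ) ((u : ℤ) + 1) ((i : ℤ) + u + 1)
  rw [show (i : ℤ) + u + 1 + ((u : ℤ) + 1) = ((i + 2 * (u + 1) : ℕ) : ℤ) by push_cast; ring, show (i : ℤ) + u + 1 - ((u : ℤ) + 1) = (i : ℤ) by ring,
    add_sub_cancel_right, show (i : ℤ) + u + 1 - 1 = ((i + u : ℕ) : ℤ) by push_cast; ring] at h
  have hrel : Polynomial.Chebyshev.T ℤ ((i + 2 * (u + 1) : ℕ) : ℤ) =
      Polynomial.Chebyshev.T ℤ (i : ℤ) + Polynomial.Chebyshev.U ℤ (u : ℤ) * (2 * (Polynomial.X ^ 2 - 1) * Polynomial.Chebyshev.U ℤ ((i + u : ℕ) : ℤ)) := by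
    linear_combination h
  have hp : (2 * (Polynomial.X ^ 2 - 1) * Polynomial.Chebyshev.U ℤ ((i + u : ℕ) : ℤ) : ℤ[X]).natDegree + u ≤ i + 2 * (u + 1) := by
    have h2 : (2 * (Polynomial.X ^ 2 - 1) : ℤ[X]).natDegree ≤ 2 := by
      refine Polynomial.natDegree_mul_le.trans ?_
      rw [show (2 : ℤ[X]) = C 2 from (Polynomial.C_ofNat 2).symm, natDegree_C, zero_add]
      exact (Polynomial.natDegree_sub_le _ _).trans (by rw [natDegree_X_pow, natDegree_one]; omega)
    have h3 := Polynomial.natDegree_mul_le (p := (2 * (Polynomial.X ^ 2 - 1) : ℤ[X])) (q := Polynomial.Chebyshev.U ℤ ((i + u : ℕ) : ℤ))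
    rw [Polynomial.Chebyshev.natDegree_U_natCast] at h3
    omega
  rw [chebyshevTU_resultant_of_T_rel hrel hp rfl, show u * (2 * (u + 1)) = 2 * (u * (u + 1)) by ring, pow_mul, neg_one_sq, one_pow, one_mul]

/-- **`T`-REFLECTION: for `i + k = u + 1`, `Res_{(k+(u+1), u)}(T_{k+(u+1)}, U_u) = (2^u)^{2k} Res_{(i,u)}(T_i, U_u)`** (from `T_{k+n} − T_{n−k} = 2(X²−1) U_{n−1} U_{k−1}`, `k ≥ 1`).
[this file, §1229] -/
theorem chebyshevTU_resultant_T_reflect {i u k : ℕ} (hik : i + k = u + 1) (hk : 1 ≤ k) :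
    (Polynomial.Chebyshev.T ℤ ((k + (u + 1) : ℕ) : ℤ)).resultant (Polynomial.Chebyshev.U ℤ (u : ℤ)) (k + (u + 1)) u =
      (2 ^ u) ^ (2 * k) * (Polynomial.Chebyshev.T ℤ (i : ℤ)).resultant (Polynomial.Chebyshev.U ℤ (u : ℤ)) i u := by
  obtain ⟨k', rfl⟩ : ∃ k', k = k' + 1 := ⟨k - 1, by omega⟩
  have h := chebyshevT_add_sub_T_sub (R := ℤ) ((u : ℤ) + 1) ((k' : ℤ) + 1)
  rw [show (k' : ℤ) + 1 + ((u : ℤ) + 1) = ((k' + 1 + (u + 1) : ℕ) : ℤ) by push_cast; ring, show (k' : ℤ) + 1 - ((u : ℤ) + 1) = -(i : ℤ) by omega,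
    Polynomial.Chebyshev.T_neg, add_sub_cancel_right, add_sub_cancel_right] at h
  have hrel : Polynomial.Chebyshev.T ℤ ((k' + 1 + (u + 1) : ℕ) : ℤ) =
      Polynomial.Chebyshev.T ℤ (i : ℤ) + Polynomial.Chebyshev.U ℤ (u : ℤ) * (2 * (Polynomial.X ^ 2 - 1) * Polynomial.Chebyshev.U ℤ (k' : ℤ)) := by
    linear_combination h
  have hp : (2 * (Polynomial.X ^ 2 - 1) * Polynomial.Chebyshev.U ℤ (k' : ℤ) : ℤ[X]).natDegree + u ≤ k' + 1 + (u + 1) := by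
    have h2 : (2 * (Polynomial.X ^ 2 - 1) : ℤ[X]).natDegree ≤ 2 := by
      refine Polynomial.natDegree_mul_le.trans ?_
      rw [show (2 : ℤ[X]) = C 2 from (Polynomial.C_ofNat 2).symm, natDegree_C, zero_add]
      exact (Polynomial.natDegree_sub_le _ _).trans (by rw [natDegree_X_pow, natDegree_one]; omega)
    have h3 := Polynomial.natDegree_mul_le (p := (2 * (Polynomial.X ^ 2 - 1) : ℤ[X])) (q := Polynomial.Chebyshev.U ℤ (k' : ℤ))
    rw [Polynomial.Chebyshev.natDegree_U_natCast] at h3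
    omega
  rw [chebyshevTU_resultant_of_T_rel hrel hp (show k' + 1 + (u + 1) = i + 2 * (k' + 1) by omega), show u * (2 * (k' + 1)) = 2 * (u * (k' + 1)) by ring, pow_mul,
    neg_one_sq, one_pow, one_mul]

/-- **Consecutive value: `Res_{(n+1, n)}(T_{n+1}, U_n) = (−1)^{n(n+1)∕2} 2^{n(n+1)}`** (`T_{n+1} = U_{n+1} − X U_n` and N406). [this file, §1229] -/
theorem chebyshevTU_resultant_pred_succ (n : ℕ) :
    (Polynomial.Chebyshev.T ℤ ((n + 1 : ℕ) : ℤ)).resultant (Polynomial.Chebyshev.U ℤ (n : ℤ)) (n + 1) n = (-1) ^ (n * (n + 1) / 2) * 2 ^ (n * (n + 1)) := by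
  have hrel : Polynomial.Chebyshev.T ℤ ((n + 1 : ℕ) : ℤ) = Polynomial.Chebyshev.U ℤ ((n : ℤ) + 1) + Polynomial.Chebyshev.U ℤ (n : ℤ) * (-Polynomial.X) := by
    rw [Nat.cast_succ, Polynomial.Chebyshev.T_eq_U_sub_X_mul_U, add_sub_cancel_right]; ring
  have hp : (-Polynomial.X : ℤ[X]).natDegree + n ≤ n + 1 := by rw [natDegree_neg, natDegree_X]; omega
  rw [hrel, Polynomial.resultant_add_mul_left _ _ _ _ _ hp (Polynomial.Chebyshev.natDegree_U_natCast ℤ n).le, chebyshevU_resultant]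


/-- Bookkeeping: in the non-vanishing case `(u+1) ∕ gcd(M, u+1)` odd, the product `M u` is even. [this file, §1229] -/
theorem even_mul_of_not_even_div {M u : ℕ} (h : ¬ Even ((u + 1) / Nat.gcd M (u + 1))) : Even (M * u) := by
  by_contra hodd
  rw [Nat.not_even_iff_odd, Nat.odd_mul] at hodd
  apply h
  have hg : Odd (Nat.gcd M (u + 1)) := Odd.of_dvd_nat hodd.1 (Nat.gcd_dvd_left M (u + 1))
  have hu : Even (Nat.gcd M (u + 1) * ((u + 1) / Nat.gcd M (u + 1))) := by
    rw [Nat.mul_div_cancel' (Nat.gcd_dvd_right M (u + 1))]; exact hodd.2.add_one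
  exact (Nat.even_mul.1 hu).resolve_left (Nat.not_even_iff_odd.2 hg)

/-- **`Res_{(m,n)}(T_m, U_n) = 0` if `(n+1) ∕ gcd(m, n+1)` is even, and `= (−1)^{mn∕2} · 2^{mn + gcd(m,n+1) − n − 1}` otherwise** (all `m, n ∈ ℕ`; integer resultant of Mathlib's `T`, `U`
with formal degrees `m`, `n`). [Dilcher–Stolarsky 2005 §3; this file, §1229] -/
theorem chebyshevTU_resultant_closed (m n : ℕ) :
    (Polynomial.Chebyshev.T ℤ (m : ℤ)).resultant (Polynomial.Chebyshev.U ℤ (n : ℤ)) m n =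
      if Even ((n + 1) / Nat.gcd m (n + 1)) then 0 else (-1) ^ (m * n / 2) * 2 ^ (m * n + Nat.gcd m (n + 1) - n - 1) := by
  obtain ⟨s, hs⟩ : ∃ s, m + n = s := ⟨_, rfl⟩
  induction s using Nat.strong_induction_on generalizing m n with
  | _ s ih =>
  rcases Nat.eq_zero_or_pos m with rfl | hm
  · -- `T_0 = 1`
    rw [Nat.cast_zero, Polynomial.Chebyshev.T_zero, Nat.gcd_zero_left, Nat.div_self (Nat.succ_pos n), if_neg Nat.not_even_one]
    simp
  obtain ⟨m, rfl⟩ : ∃ m', m = m' + 1 := ⟨m - 1, by omega⟩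
  rcases Nat.lt_or_ge m n with hmn | hmn
  · -- `n > m`: reduce the `U`-index `n` modulo `2(m+1)`
    rcases Nat.lt_or_ge n (2 * m + 1) with h2 | h2
    · -- `U`-reflection: `n = k + (m+1)` with `j + k + 1 = m`
      obtain ⟨k, j, rfl, hjk⟩ : ∃ k j, n = k + (m + 1) ∧ j + k + 1 = m := ⟨n - (m + 1), 2 * m - n, by omega, by omega⟩
      subst hjk
      obtain ⟨hg, hodd⟩ := gcd_eq_and_odd_div_iff_of_add_eq (m := j + k + 1 + 1) (n := k + (j + k + 1 + 1) + 1) (j := j + 1) (q := 1) (by ring)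
      rw [chebyshevTU_resultant_U_reflect rfl, ih (j + k + 1 + 1 + j) (by omega) (j + k + 1 + 1) j rfl, hg]
      by_cases hP : Even ((j + 1) / Nat.gcd (j + k + 1 + 1) (j + 1))
      · rw [if_pos hP, if_pos (by rw [← Nat.not_odd_iff_even, hodd, Nat.not_odd_iff_even]; exact hP), mul_zero]
      · have hP' : ¬ Even ((k + (j + k + 1 + 1) + 1) / Nat.gcd (j + k + 1 + 1) (j + 1)) := by
          rw [← Nat.not_odd_iff_even, hodd, Nat.not_odd_iff_even]; exact hP
        rw [if_neg hP, if_neg hP']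
        have hev : Even ((j + k + 1 + 1) * (k + (j + k + 1 + 1))) := even_mul_of_not_even_div (hg.symm ▸ hP')
        have hk1 : Even ((j + k + 1 + 1) * (k + 1)) := by
          rcases Nat.even_or_odd (j + k + 1 + 1) with he | ho
          · exact he.mul_right _
          · have hu : Even (k + (j + k + 1 + 1)) := (Nat.even_mul.1 hev).resolve_left (Nat.not_even_iff_odd.2 ho)
            have hk : Odd k := by
              rcases Nat.even_or_odd k with hk | hk
              · exact absurd (by simpa [Nat.even_add, hk] using hu) (Nat.not_even_iff_odd.2 ho)
              · exact hk
            exact (hk.add_one).mul_left _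
        have hdiv : (j + k + 1 + 1) * (k + (j + k + 1 + 1)) / 2 = (j + k + 1 + 1) * j / 2 + (j + k + 1 + 1) * (k + 1) := by
          rw [show (j + k + 1 + 1) * (k + (j + k + 1 + 1)) = (j + k + 1 + 1) * j + 2 * ((j + k + 1 + 1) * (k + 1)) by ring,
            Nat.add_mul_div_left _ _ (by norm_num : 0 < 2)]
        have hexp : (j + k + 1 + 1) * (k + (j + k + 1 + 1)) + Nat.gcd (j + k + 1 + 1) (j + 1) - (k + (j + k + 1 + 1)) - 1 =
            ((j + k + 1 + 1) * j + Nat.gcd (j + k + 1 + 1) (j + 1) - j - 1) + (j + k + 1) * (2 * (k + 1)) := by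
          have h1 := succ_le_mul_add_gcd (j + k + 1 + 1) j
          have h3 : (j + k + 1 + 1) * (k + (j + k + 1 + 1)) = (j + k + 1 + 1) * j + (j + k + 1) * (2 * (k + 1)) + 2 * (k + 1) := by ring
          omega
        rw [hdiv, hexp, pow_add (-1 : ℤ) ((j + k + 1 + 1) * j / 2) ((j + k + 1 + 1) * (k + 1)), Even.neg_one_pow hk1, mul_one]
        ring
    · rcases Nat.eq_or_lt_of_le h2 with h3 | h3
      · -- `n = 2m + 1`: `U_{2m+1} = 2 T_{m+1} U_m`
        subst h3
        rw [chebyshevTU_resultant_U_two_mul_pred, show 2 * m + 1 + 1 = (m + 1) * 2 by ring, Nat.gcd_mul_right_right, Nat.mul_div_cancel_left 2 (Nat.succ_pos m), if_pos even_two]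
      · -- `U`-shift: `n = j + 2(m+1)`
        obtain ⟨j, rfl⟩ : ∃ j, n = j + 2 * (m + 1) := ⟨n - 2 * (m + 1), by omega⟩
        obtain ⟨hg, hodd⟩ := gcd_eq_and_odd_div_iff_of_eq_add (m := m + 1) (n := j + 2 * (m + 1) + 1) (j := j + 1) (q := 1) (by ring)
        rw [chebyshevTU_resultant_U_add_two_mul, ih (m + 1 + j) (by omega) (m + 1) j rfl, hg]
        by_cases hP : Even ((j + 1) / Nat.gcd (m + 1) (j + 1))
        · rw [if_pos hP, if_pos (by rw [← Nat.not_odd_iff_even, hodd, Nat.not_odd_iff_even]; exact hP), mul_zero]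
        · have hP' : ¬ Even ((j + 2 * (m + 1) + 1) / Nat.gcd (m + 1) (j + 1)) := by
            rw [← Nat.not_odd_iff_even, hodd, Nat.not_odd_iff_even]; exact hP
          rw [if_neg hP, if_neg hP']
          have hdiv : (m + 1) * (j + 2 * (m + 1)) / 2 = (m + 1) * j / 2 + (m + 1) * (m + 1) := by
            rw [show (m + 1) * (j + 2 * (m + 1)) = (m + 1) * j + 2 * ((m + 1) * (m + 1)) by ring, Nat.add_mul_div_left _ _ (by norm_num : 0 < 2)]
          have hexp : (m + 1) * (j + 2 * (m + 1)) + Nat.gcd (m + 1) (j + 1) - (j + 2 * (m + 1)) - 1 =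
              ((m + 1) * j + Nat.gcd (m + 1) (j + 1) - j - 1) + m * (2 * (m + 1)) := by
            have h1 := succ_le_mul_add_gcd (m + 1) j
            have h4 : (m + 1) * (j + 2 * (m + 1)) = (m + 1) * j + m * (2 * (m + 1)) + 2 * (m + 1) := by ring
            omega
          have hsgn : ((-1 : ℤ)) ^ ((m + 1) * (m + 1)) = (-1) ^ (m + 1) := by
            rcases Nat.even_or_odd (m + 1) with h | h
            · rw [Even.neg_one_pow h, Even.neg_one_pow (h.mul_right _)]
            · rw [Odd.neg_one_pow h, Odd.neg_one_pow (h.mul h)]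
          rw [hdiv, hexp, pow_add (-1 : ℤ) ((m + 1) * j / 2) ((m + 1) * (m + 1)), hsgn]
          ring
  · rcases Nat.eq_or_lt_of_le hmn with h3 | hnm
    · -- `n = m`: the consecutive pair
      subst h3
      rw [chebyshevTU_resultant_pred_succ, Nat.gcd_self, Nat.div_self (Nat.succ_pos n), if_neg Nat.not_even_one, mul_comm (n + 1) n,
        show n * (n + 1) + (n + 1) - n - 1 = n * (n + 1) by omega]
    · -- `n < m`: reduce the `T`-index `m + 1` modulo `2(n+1)`
      rcases Nat.lt_or_ge (m + 1) (2 * (n + 1)) with h2 | h2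
      · -- `T`-reflection: `m + 1 = k + (n+1)` with `i + k = n + 1`, `k ≥ 1`
        obtain ⟨k, i, hmk, hik⟩ : ∃ k i, m + 1 = k + (n + 1) ∧ i + k = n + 1 := ⟨m - n, 2 * n + 1 - m, by omega, by omega⟩
        obtain ⟨hg, -⟩ := gcd_eq_and_odd_div_iff_of_add_eq (m := n + 1) (n := k + (n + 1)) (j := i) (q := 1) (by omega)
        rw [Nat.gcd_comm (n + 1) (k + (n + 1)), Nat.gcd_comm (n + 1) i] at hg
        have hcast : ((m + 1 : ℕ) : ℤ) = ((k + (n + 1) : ℕ) : ℤ) := by rw [hmk]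
        rw [hcast, hmk, chebyshevTU_resultant_T_reflect hik (by omega), ih (i + n) (by omega) i n rfl, hg]
        by_cases hP : Even ((n + 1) / Nat.gcd i (n + 1))
        · rw [if_pos hP, if_pos hP, mul_zero]
        · rw [if_neg hP, if_neg hP]
          have hkn : Even (k * n) := by
            rcases Nat.even_or_odd n with hn | hn
            · exact hn.mul_left _
            · have hq : ¬ Even ((n + 1) / Nat.gcd i (n + 1)) := hP
              have hge : Even (Nat.gcd i (n + 1)) := by
                by_contra hg'
                have hprod : Even (Nat.gcd i (n + 1) * ((n + 1) / Nat.gcd i (n + 1))) := by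
                  rw [Nat.mul_div_cancel' (Nat.gcd_dvd_right i (n + 1))]; exact hn.add_one
                exact hq ((Nat.even_mul.1 hprod).resolve_left hg')
              have hMe : Even (k + (n + 1)) := by
                have hd : Nat.gcd (k + (n + 1)) (n + 1) ∣ k + (n + 1) := Nat.gcd_dvd_left _ _
                rw [hg] at hd
                exact even_iff_two_dvd.2 ((even_iff_two_dvd.1 hge).trans hd)
              have hke : Even k := by
                rcases Nat.even_or_odd k with hk | hk
                · exact hk
                · exact absurd hMe (Nat.not_even_iff_odd.2 (hk.add_even hn.add_one))
              exact hke.mul_right _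
          have hdiv : (k + (n + 1)) * n / 2 = i * n / 2 + k * n := by
            rw [show (k + (n + 1)) * n = i * n + 2 * (k * n) by nlinarith [hik], Nat.add_mul_div_left _ _ (by norm_num : 0 < 2)]
          have hexp : (k + (n + 1)) * n + Nat.gcd i (n + 1) - n - 1 = (i * n + Nat.gcd i (n + 1) - n - 1) + n * (2 * k) := by
            have h1 := succ_le_mul_add_gcd i n
            have h4 : (k + (n + 1)) * n = i * n + n * (2 * k) := by nlinarith [hik]
            omega
          rw [hdiv, hexp, pow_add (-1 : ℤ) (i * n / 2) (k * n), Even.neg_one_pow hkn, mul_one]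
          ring
      · -- `T`-shift: `m + 1 = i + 2(n+1)`
        obtain ⟨i, hmi⟩ : ∃ i, m + 1 = i + 2 * (n + 1) := ⟨m + 1 - 2 * (n + 1), by omega⟩
        obtain ⟨hg, -⟩ := gcd_eq_and_odd_div_iff_of_eq_add (m := n + 1) (n := i + 2 * (n + 1)) (j := i) (q := 1) (by ring)
        rw [Nat.gcd_comm (n + 1) (i + 2 * (n + 1)), Nat.gcd_comm (n + 1) i] at hg
        have hcast : ((m + 1 : ℕ) : ℤ) = ((i + 2 * (n + 1) : ℕ) : ℤ) := by rw [hmi]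
        rw [hcast, hmi, chebyshevTU_resultant_T_add_two_mul, ih (i + n) (by omega) i n rfl, hg]
        by_cases hP : Even ((n + 1) / Nat.gcd i (n + 1))
        · rw [if_pos hP, if_pos hP, mul_zero]
        · rw [if_neg hP, if_neg hP]
          have hdiv : (i + 2 * (n + 1)) * n / 2 = i * n / 2 + n * (n + 1) := by
            rw [show (i + 2 * (n + 1)) * n = i * n + 2 * (n * (n + 1)) by ring, Nat.add_mul_div_left _ _ (by norm_num : 0 < 2)]
          have hexp : (i + 2 * (n + 1)) * n + Nat.gcd i (n + 1) - n - 1 = (i * n + Nat.gcd i (n + 1) - n - 1) + n * (2 * (n + 1)) := by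
            have h1 := succ_le_mul_add_gcd i n
            have h4 : (i + 2 * (n + 1)) * n = i * n + n * (2 * (n + 1)) := by ring
            omega
          rw [hdiv, hexp, pow_add (-1 : ℤ) (i * n / 2) (n * (n + 1)), Even.neg_one_pow (Nat.even_mul_succ_self n), mul_one]
          ring

end Summit.Ventures.HSemireg.Wedge.HankelOuter
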